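import Mathlib
import HarnessLib
import Summits.NavierStokesRegularity.NavierStokesRegularity.Theorems.TaylorModelRungThreeCertificateStaticSound

/-!
# Crux K1b-DR (stmt-NavierStokesRegularity-23954), line `taylor-model` — certificate SOUNDNESS for the `Static`
# block, part 2: the slack series (uniform in `L`), the datum clause, and the assembled `static_of_check`

The SLACK-SERIES clause of `Static` quantifies over every number `L` of past epochs:
`slackWeight 1 θ c env L k = c·2^{2k}·Σ_{d=1}^{L} 2^{(5/2+θ)d}·env(k+d)` with the three-piece envelope `env`. For a
window shell `k` and `d ≥ 1` the behind-window branch of `env` never occurs; the window terms are majorised by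
`q52^d (M²/2 + W)` (`2^{5/2+θ} ≤ q52`) and summed over ALL `d ≤ Ka − k` (`slackWin`), the ahead terms form a geometric
series with ratio `ρ = q52/2^7 < 1` from `d₀ = Ka − k + 1` on, bounded by `ρ^{d₀}/(1−ρ)` (`slackTail`) — so
`slackWeight … L k ≤ φ (slackK kk)` for every `L` (`slackWeight_le_slackK`). The datum clause: the window values of
`datumState i₀ X₀` are `φ (datumK c)`. Then **`static_of_check : Monotone φ → checkStatic T B = true →
(toCertData φ T).Static`**.

MODEL-lattice rung TL-M3 only; nothing here is a statement about the Navier–Stokes equations.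
-/

-- the sub-problem namespace repeats the summit name by design (D-0017)
set_option linter.dupNamespace false

namespace Summit.NavierStokesRegularity.NavierStokesRegularity.Theorems.TaylorModelCert

open scoped BigOperators
open Literature.Analysis.FluidPDE.TaoCascade Literature.Analysis.FluidPDE.TaoCascade.TaylorChain

/-! ### Real-analysis helpers for the slack series -/

section SlackReal

/-- `2^{(5/2+θ)d} ≤ q^d` once `2^{5/2+θ} ≤ q`. [folklore] -/
theorem two_rpow_epoch_le {θ q : ℝ} (hq : (2:ℝ) ^ ((5:ℝ) / 2 + θ) ≤ q) (d : ℕ) :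
    (2:ℝ) ^ (((5:ℝ) / 2 + θ) * (d:ℝ)) ≤ q ^ d := by
  rw [Real.rpow_mul (by norm_num : (0:ℝ) ≤ 2), Real.rpow_natCast]
  exact pow_le_pow_left₀ (by positivity) hq d

/-- `2^{-7(k+d)} = 2^{-7k} · (1/2^7)^d` (real exponent on the left, integer power on the right). [folklore] -/
theorem two_rpow_neg_seven (k : ℤ) (d : ℕ) :
    (2:ℝ) ^ (-(7:ℝ) * (((k + (d:ℤ) : ℤ)) : ℝ)) = (2:ℝ) ^ (-(7 * k) : ℤ) * (1 / 2 ^ 7) ^ d := by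
  have e : (-(7:ℝ) * (((k + (d:ℤ) : ℤ)) : ℝ)) = (((-(7 * k) : ℤ)) : ℝ) + (-(7 * (d:ℝ))) := by push_cast; ring
  rw [e, Real.rpow_add (by norm_num : (0:ℝ) < 2), Real.rpow_intCast]
  congr 1
  rw [show (-(7 * (d:ℝ))) = -(((7 * d : ℕ)) : ℝ) by push_cast; ring, Real.rpow_neg (by norm_num), Real.rpow_natCast,
    pow_mul, one_div, inv_pow]

/-- Geometric tail over a finite set of exponents `≥ d₀`: `Σ_{d ∈ S} ρ^d ≤ ρ^{d₀}/(1 − ρ)`. [folklore] -/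
theorem sum_pow_le_geom_tail {ρ : ℝ} (h0 : 0 ≤ ρ) (h1 : ρ < 1) (d₀ : ℕ) (S : Finset ℕ) (hS : ∀ d ∈ S, d₀ ≤ d) :
    ∑ d ∈ S, ρ ^ d ≤ ρ ^ d₀ / (1 - ρ) := by
  classical
  have e : ∑ d ∈ S, ρ ^ d = ρ ^ d₀ * ∑ d ∈ S, ρ ^ (d - d₀) := by
    rw [Finset.mul_sum]
    refine Finset.sum_congr rfl fun d hd => ?_
    rw [← pow_add]; congr 1; have := hS d hd; omega
  rw [e, div_eq_mul_inv]
  refine mul_le_mul_of_nonneg_left ?_ (pow_nonneg h0 _)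
  have hinj : ∀ a ∈ S, ∀ b ∈ S, a - d₀ = b - d₀ → a = b := by
    intro a ha b hb hab; have := hS a ha; have := hS b hb; omega
  rw [← Finset.sum_image hinj]
  have hs := summable_geometric_of_lt_one h0 h1
  calc ∑ u ∈ S.image (fun a => a - d₀), ρ ^ u ≤ ∑' u : ℕ, ρ ^ u := hs.sum_le_tsum _ (fun u _ => pow_nonneg h0 u)
    _ = (1 - ρ)⁻¹ := tsum_geometric_of_lt_one h0 h1

end SlackReal

namespace CertTables

/-! ### The slack series is majorised by `slackK`, uniformly in `L` -/

section Slack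

variable {K : Type} [Field K] [LinearOrder K] {φ : K →+* ℝ} (hφ : Monotone φ) (T : CertTables K)
  (B : StaticAux K)
include hφ

omit [LinearOrder K] hφ in
/-- `φ (slackWin kk)` as a real sum over `d = 1 … m-1-kk` (indexed by `t = d − 1`). [folklore] -/
theorem phi_slackWin (kk : ℕ) : φ (T.slackWin B kk) =
    ∑ t ∈ Finset.range (T.m - 1 - kk),
      φ B.q52 ^ (t + 1) * (φ (T.Mw (kk + t + 1)) ^ 2 / 2 + φ (T.Ww (kk + t + 1))) := by
  unfold slackWin
  rw [phi_sumN]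
  refine Finset.sum_congr rfl fun t _ => ?_
  rw [map_mul, map_pow, map_add, map_div₀, map_pow, map_ofNat]

omit [LinearOrder K] hφ in
/-- `φ (slackTail kk)` in real terms. [folklore] -/
theorem phi_slackTail (kk : ℕ) : φ (T.slackTail B kk) =
    5 * φ T.Cg * (2:ℝ) ^ (-(7 * ((kk:ℤ) - T.Kb)) : ℤ) * (φ B.q52 / 2 ^ 7) ^ (T.m - kk) / (1 - φ B.q52 / 2 ^ 7) := by
  unfold slackTail
  rw [map_div₀, map_mul, map_mul, map_mul, map_pow, map_div₀, map_sub, map_one, map_div₀, map_pow, map_ofNat,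
    map_ofNat, map_zpow₀, map_ofNat]

/-- **The slack series is bounded by `φ (slackK kk)` for every `L`** (window shell `k = kk − Kb`). [folklore] -/
theorem slackWeight_le_slackK (haux : T.checkStaticAux B = true) (hsc : T.checkStaticScalars B = true)
    {kk : ℕ} (hkk : kk < T.m) (L : ℕ) :
    slackWeight 1 (T.toCertData φ).θ (T.toCertData φ).c
      (fun j : ℤ => if j < -(T.toCertData φ).Kb then 2 * ((T.toCertData φ).Cb * (2:ℝ) ^ ((3:ℝ) / 4 * (-(j:ℝ)))) ^ 2
        else if (T.toCertData φ).Ka < j then 5 * ((T.toCertData φ).Cg * (2:ℝ) ^ (-(7:ℝ) * (j:ℝ)))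
        else (1 / 2) * (T.toCertData φ).M j ^ 2 + (T.toCertData φ).W j) L ((kk:ℤ) - T.Kb) ≤
      φ (T.slackK B kk) := by
  obtain ⟨hKb, hKa, hCg0, -, -, -, -, -, hq0, hq, hq7⟩ := T.staticAux_sound hφ B haux
  have hsc' := hsc
  simp only [checkStaticScalars, allN_eq_true, Bool.and_eq_true, Bool.not_eq_true', decide_eq_false_iff_not,
    decide_eq_true_eq] at hsc'
  obtain ⟨⟨⟨⟨⟨⟨⟨⟨⟨⟨⟨⟨⟨⟨⟨⟨⟨-, -⟩, -⟩, -⟩, hc⟩, -⟩, -⟩, -⟩, -⟩, -⟩, -⟩, -⟩, -⟩, -⟩, hMW⟩, -⟩, -⟩, -⟩ := hsc'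
  have hm : (T.m : ℤ) = T.Ka + T.Kb + 1 := T.m_eq_of_InW (k := 1) ⟨by omega, hKa⟩
  set k : ℤ := (kk:ℤ) - T.Kb with hkdef
  set q : ℝ := φ B.q52 with hqdef
  set ρ : ℝ := q / 2 ^ 7 with hρdef
  have hρ0 : 0 ≤ ρ := by positivity
  have hρ1 : ρ < 1 := by rw [hρdef, div_lt_one (by positivity)]; exact hq7
  have hc' : 0 < φ T.c := phi_pos hφ hc
  -- unfold the slack weight
  unfold slackWeight
  change φ T.c * (1 + 1:ℝ) ^ ((2:ℝ) * (k:ℝ)) * ∑ d ∈ Finset.Icc 1 L, (1 + 1:ℝ) ^ ((5 / 2 + φ T.θ) * (d:ℝ)) *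
      (if k + (d:ℤ) < -T.Kb then 2 * (φ T.Cb * (2:ℝ) ^ ((3:ℝ) / 4 * (-((k + (d:ℤ) : ℤ):ℝ)))) ^ 2
        else if T.Ka < k + (d:ℤ) then 5 * (φ T.Cg * (2:ℝ) ^ (-(7:ℝ) * ((k + (d:ℤ) : ℤ):ℝ)))
        else (1 / 2) * (T.toCertData φ).M (k + (d:ℤ)) ^ 2 + (T.toCertData φ).W (k + (d:ℤ))) ≤ φ (T.slackK B kk)
  rw [show (1 + 1 : ℝ) = 2 by norm_num]
  -- the prefactor
  have e2k : (2:ℝ) ^ ((2:ℝ) * (k:ℝ)) = φ ((2:K) ^ (2 * ((kk:ℤ) - T.Kb))) := by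
    rw [map_zpow₀, map_ofNat, ← Real.rpow_intCast]; congr 1; push_cast; rw [hkdef]; push_cast; ring
  -- termwise majorants
  set g₁ : ℕ → ℝ := fun d => q ^ d * (φ (T.Mw (kk + d)) ^ 2 / 2 + φ (T.Ww (kk + d))) with hg₁
  set g₂ : ℕ → ℝ := fun d => 5 * φ T.Cg * (2:ℝ) ^ (-(7 * k) : ℤ) * ρ ^ d with hg₂
  have hg₁0 : ∀ d, kk + d < T.m → 0 ≤ g₁ d := by
    intro d hd
    have := (hMW (kk + d) hd).2
    have hW : 0 ≤ φ (T.Ww (kk + d)) := phi_nonneg hφ this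
    simp only [hg₁]; positivity
  have hg₂0 : ∀ d, 0 ≤ g₂ d := fun d => by simp only [hg₂]; positivity
  have hterm : ∀ d ∈ Finset.Icc 1 L,
      (2:ℝ) ^ ((5 / 2 + φ T.θ) * (d:ℝ)) *
        (if k + (d:ℤ) < -T.Kb then 2 * (φ T.Cb * (2:ℝ) ^ ((3:ℝ) / 4 * (-((k + (d:ℤ) : ℤ):ℝ)))) ^ 2
          else if T.Ka < k + (d:ℤ) then 5 * (φ T.Cg * (2:ℝ) ^ (-(7:ℝ) * ((k + (d:ℤ) : ℤ):ℝ)))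
          else (1 / 2) * (T.toCertData φ).M (k + (d:ℤ)) ^ 2 + (T.toCertData φ).W (k + (d:ℤ))) ≤
      (if k + (d:ℤ) ≤ T.Ka then g₁ d else g₂ d) := by
    intro d hd
    rw [Finset.mem_Icc] at hd
    have hpow := two_rpow_epoch_le hq d
    have hnot : ¬ (k + (d:ℤ) < -T.Kb) := by rw [hkdef]; omega
    rw [if_neg hnot]
    by_cases hin : k + (d:ℤ) ≤ T.Ka
    · rw [if_neg (not_lt.2 hin), if_pos hin]
      have hwin : -T.Kb ≤ k + (d:ℤ) ∧ k + (d:ℤ) ≤ T.Ka := ⟨by rw [hkdef]; omega, hin⟩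
      have eidx : (k + (d:ℤ) + T.Kb).toNat = kk + d := by rw [hkdef]; omega
      rw [T.sn_M φ hwin, T.sn_W φ hwin, eidx]
      have hlt : kk + d < T.m := by have := hin; rw [hkdef] at this; omega
      have hW : 0 ≤ φ (T.Ww (kk + d)) := phi_nonneg hφ (hMW (kk + d) hlt).2
      have henv : 0 ≤ (1 / 2) * φ (T.Mw (kk + d)) ^ 2 + φ (T.Ww (kk + d)) := by positivity
      calc (2:ℝ) ^ ((5 / 2 + φ T.θ) * (d:ℝ)) * ((1 / 2) * φ (T.Mw (kk + d)) ^ 2 + φ (T.Ww (kk + d)))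
          ≤ q ^ d * ((1 / 2) * φ (T.Mw (kk + d)) ^ 2 + φ (T.Ww (kk + d))) :=
            mul_le_mul_of_nonneg_right hpow henv
        _ = g₁ d := by simp only [hg₁]; ring
    · rw [if_pos (lt_of_not_ge hin), if_neg hin, two_rpow_neg_seven k d]
      have henv : 0 ≤ 5 * (φ T.Cg * ((2:ℝ) ^ (-(7 * k) : ℤ) * (1 / 2 ^ 7) ^ d)) := by positivity
      calc (2:ℝ) ^ ((5 / 2 + φ T.θ) * (d:ℝ)) * (5 * (φ T.Cg * ((2:ℝ) ^ (-(7 * k) : ℤ) * (1 / 2 ^ 7) ^ d)))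
          ≤ q ^ d * (5 * (φ T.Cg * ((2:ℝ) ^ (-(7 * k) : ℤ) * (1 / 2 ^ 7) ^ d))) :=
            mul_le_mul_of_nonneg_right hpow henv
        _ = g₂ d := by
            simp only [hg₂, hρdef]
            rw [div_pow, div_pow, one_pow]
            ring
  -- sum the majorants and split window / ahead
  have hsum : ∑ d ∈ Finset.Icc 1 L, (2:ℝ) ^ ((5 / 2 + φ T.θ) * (d:ℝ)) *
        (if k + (d:ℤ) < -T.Kb then 2 * (φ T.Cb * (2:ℝ) ^ ((3:ℝ) / 4 * (-((k + (d:ℤ) : ℤ):ℝ)))) ^ 2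
          else if T.Ka < k + (d:ℤ) then 5 * (φ T.Cg * (2:ℝ) ^ (-(7:ℝ) * ((k + (d:ℤ) : ℤ):ℝ)))
          else (1 / 2) * (T.toCertData φ).M (k + (d:ℤ)) ^ 2 + (T.toCertData φ).W (k + (d:ℤ))) ≤
      φ (T.slackWin B kk) + φ (T.slackTail B kk) := by
    refine (Finset.sum_le_sum hterm).trans ?_
    rw [← Finset.sum_filter_add_sum_filter_not (Finset.Icc 1 L) (fun d : ℕ => k + (d:ℤ) ≤ T.Ka)]
    refine add_le_add ?_ ?_
    · -- window part ≤ slackWin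
      have e1 : ∑ d ∈ (Finset.Icc 1 L).filter (fun d : ℕ => k + (d:ℤ) ≤ T.Ka),
          (if k + (d:ℤ) ≤ T.Ka then g₁ d else g₂ d) =
          ∑ d ∈ (Finset.Icc 1 L).filter (fun d : ℕ => k + (d:ℤ) ≤ T.Ka), g₁ d :=
        Finset.sum_congr rfl fun d hd => by rw [if_pos (Finset.mem_filter.1 hd).2]
      rw [e1, T.phi_slackWin B kk]
      have e2 : ∑ t ∈ Finset.range (T.m - 1 - kk),
          φ B.q52 ^ (t + 1) * (φ (T.Mw (kk + t + 1)) ^ 2 / 2 + φ (T.Ww (kk + t + 1))) =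
          ∑ d ∈ (Finset.range (T.m - 1 - kk)).image (fun t => t + 1), g₁ d := by
        rw [Finset.sum_image (fun a _ b _ h => by omega)]
        refine Finset.sum_congr rfl fun t _ => ?_
        simp only [hg₁, hqdef, add_assoc]
      rw [e2]
      refine Finset.sum_le_sum_of_subset_of_nonneg ?_ ?_
      · intro d hd
        rw [Finset.mem_filter, Finset.mem_Icc] at hd
        rw [Finset.mem_image]
        refine ⟨d - 1, ?_, by omega⟩
        rw [Finset.mem_range]
        have := hd.2; rw [hkdef] at this; omega
      · intro d hd _
        rw [Finset.mem_image] at hd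
        obtain ⟨t, ht, rfl⟩ := hd
        rw [Finset.mem_range] at ht
        exact hg₁0 _ (by omega)
    · -- ahead part ≤ slackTail
      have e1 : ∑ d ∈ (Finset.Icc 1 L).filter (fun d : ℕ => ¬ (k + (d:ℤ) ≤ T.Ka)),
          (if k + (d:ℤ) ≤ T.Ka then g₁ d else g₂ d) =
          ∑ d ∈ (Finset.Icc 1 L).filter (fun d : ℕ => ¬ (k + (d:ℤ) ≤ T.Ka)), g₂ d :=
        Finset.sum_congr rfl fun d hd => by rw [if_neg (Finset.mem_filter.1 hd).2]
      rw [e1]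
      simp only [hg₂]
      rw [← Finset.mul_sum, T.phi_slackTail B kk]
      have htail := sum_pow_le_geom_tail hρ0 hρ1 (T.m - kk)
        ((Finset.Icc 1 L).filter (fun d : ℕ => ¬ (k + (d:ℤ) ≤ T.Ka))) (by
          intro d hd
          rw [Finset.mem_filter] at hd
          have := hd.2; rw [hkdef] at this; omega)
      have hpre : 0 ≤ 5 * φ T.Cg * (2:ℝ) ^ (-(7 * k) : ℤ) := by positivity
      have ek : (-(7 * k) : ℤ) = -(7 * ((kk:ℤ) - T.Kb)) := by rw [hkdef]
      rw [ek] at hpre ⊢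
      calc 5 * φ T.Cg * (2:ℝ) ^ (-(7 * ((kk:ℤ) - T.Kb)) : ℤ) * ∑ d ∈ (Finset.Icc 1 L).filter
              (fun d : ℕ => ¬ (k + (d:ℤ) ≤ T.Ka)), ρ ^ d
          ≤ 5 * φ T.Cg * (2:ℝ) ^ (-(7 * ((kk:ℤ) - T.Kb)) : ℤ) * (ρ ^ (T.m - kk) / (1 - ρ)) :=
            mul_le_mul_of_nonneg_left htail hpre
        _ = _ := by rw [hρdef, hqdef]; ring
  -- assemble
  have hpre : 0 ≤ φ T.c * (2:ℝ) ^ ((2:ℝ) * (k:ℝ)) := by positivity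
  calc φ T.c * (2:ℝ) ^ ((2:ℝ) * (k:ℝ)) * _ ≤ φ T.c * (2:ℝ) ^ ((2:ℝ) * (k:ℝ)) *
        (φ (T.slackWin B kk) + φ (T.slackTail B kk)) := mul_le_mul_of_nonneg_left hsum hpre
    _ = φ (T.slackK B kk) := by unfold slackK; rw [map_mul, map_mul, map_add, ← e2k]

/-- Soundness of `checkSlack`: the slack-series clause of `Static`, for every `L`. [folklore] -/
theorem static_slack (haux : T.checkStaticAux B = true) (hsc : T.checkStaticScalars B = true)
    (hsl : T.checkSlack B = true) :
    ∀ (L : ℕ) (k : ℤ), -(T.toCertData φ).Kb ≤ k → k ≤ (T.toCertData φ).Ka →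
      2 * slackWeight 1 (T.toCertData φ).θ (T.toCertData φ).c
        (fun j : ℤ => if j < -(T.toCertData φ).Kb then 2 * ((T.toCertData φ).Cb * (2:ℝ) ^ ((3:ℝ) / 4 * (-(j:ℝ)))) ^ 2
          else if (T.toCertData φ).Ka < j then 5 * ((T.toCertData φ).Cg * (2:ℝ) ^ (-(7:ℝ) * (j:ℝ)))
          else (1 / 2) * (T.toCertData φ).M j ^ 2 + (T.toCertData φ).W j) L k +
        ((T.toCertData φ).c * (2:ℝ) ^ ((2:ℝ) * (k:ℝ)) + 1) * (T.toCertData φ).M k ^ 2 ≤ (T.toCertData φ).W k := by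
  obtain ⟨hKb, hKa, -, -, -, -, -, -, -, -, -⟩ := T.staticAux_sound hφ B haux
  simp only [checkSlack, allN_eq_true, decide_eq_true_eq] at hsl
  intro L k hk1 hk2
  change -T.Kb ≤ k at hk1
  change k ≤ T.Ka at hk2
  have hlt : (k + T.Kb).toNat < T.m := T.toNat_shell_lt_m ⟨hk1, hk2⟩
  have ek : k = (((k + T.Kb).toNat : ℕ) : ℤ) - T.Kb := by omega
  have hmain := T.slackWeight_le_slackK hφ B haux hsc hlt L
  rw [← ek] at hmain
  have hchk := hφ (hsl _ hlt)
  rw [map_add, map_mul, map_mul, map_pow, map_add, map_mul, map_one, map_ofNat] at hchk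
  rw [T.sn_M φ ⟨hk1, hk2⟩, T.sn_W φ ⟨hk1, hk2⟩]
  have e2k : (2:ℝ) ^ ((2:ℝ) * (k:ℝ)) = φ ((2:K) ^ (2 * ((((k + T.Kb).toNat : ℕ) : ℤ) - T.Kb))) := by
    rw [map_zpow₀, map_ofNat, ← Real.rpow_intCast]; congr 1; rw [← ek]; push_cast; ring
  have ec : (T.toCertData φ).c = φ T.c := rfl
  rw [e2k]
  rw [ec] at hmain ⊢
  linarith [hmain, hchk]

end Slack

/-! ### The datum clause -/

section Datum

variable {K : Type} [Field K] [LinearOrder K] {φ : K →+* ℝ} (hφ : Monotone φ) (T : CertTables K)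
include hφ

/-- Window values of the rescaled datum are `φ (datumK c)`. [folklore] -/
theorem wv_datum (hKb : 0 ≤ T.Kb) (c : ℕ) :
    T.wv (datumState (T.toCertData φ).i₀ (T.toCertData φ).X₀) c = φ (T.datumK c) := by
  unfold wv datumState datumK
  change (if T.wk c = 0 then φ (vget T.X₀ (T.wi c).val) else 0) / |φ (vget T.X₀ T.i₀.val)| = _
  have hiff : T.wk c = 0 ↔ c % T.m = T.Kb.toNat := by unfold wk; omega
  have ewi : (T.wi c).val = c / T.m % 4 := rfl
  by_cases h0 : T.wk c = 0
  · rw [if_pos h0, if_pos (hiff.1 h0), map_div₀, phi_abs hφ, ewi]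
  · rw [if_neg h0, if_neg (fun h' => h0 (hiff.2 h')), zero_div, map_zero]

/-- Soundness of `checkDatum`: the datum clause of `Static` (every face index; junk `0` beyond the tables).
[folklore] -/
theorem static_datum (hKb : 0 ≤ T.Kb) (h : T.checkDatum = true) :
    ∀ l, |(T.toCertData φ).ℓ 0 l (datumState (T.toCertData φ).i₀ (T.toCertData φ).X₀) - (T.toCertData φ).ctr 0 l| ≤
      (T.toCertData φ).rad 0 l - (T.toCertData φ).s 0 l := by
  simp only [checkDatum, allN_eq_true, decide_eq_true_eq] at h
  intro l
  change |T.covR φ ((T.stage 0).ell.getD l []) _ - φ (vget (T.stage 0).ctr l)| ≤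
    φ (vget (T.stage 0).rad l) - φ (vget (T.stage 0).s l)
  by_cases hl : l < T.nFaces0
  · have hchk := hφ (h l hl)
    rw [phi_abs hφ, map_sub, map_sub, phi_sumN] at hchk
    rw [T.covR_apply φ]
    have e : ∑ c ∈ Finset.range T.n, φ (vget ((T.stage 0).ell.getD l []) c) *
        T.wv (datumState (T.toCertData φ).i₀ (T.toCertData φ).X₀) c =
        ∑ c ∈ Finset.range T.n, φ (vget ((T.stage 0).ell.getD l []) c * T.datumK c) := by
      refine Finset.sum_congr rfl fun c hc => ?_
      rw [Finset.mem_range] at hc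
      rw [T.wv_datum hφ hKb c, map_mul]
    rw [e]
    exact hchk
  · rw [not_lt] at hl
    unfold nFaces0 at hl
    simp only [max_le_iff] at hl
    obtain ⟨⟨hl1, hl2⟩, hl3, hl4⟩ := hl
    have e1 : (T.stage 0).ell.getD l [] = [] := List.getD_eq_default _ _ hl1
    rw [e1, T.covR_nil φ, vget_of_le _ hl2, vget_of_le _ hl3, vget_of_le _ hl4]
    simp

end Datum

/-! ### The assembled theorem -/

section Assembly

variable {K : Type} [Field K] [LinearOrder K] {φ : K →+* ℝ} (hφ : Monotone φ) (T : CertTables K)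
  (B : StaticAux K)
include hφ

/-- **Soundness of the `Static` checker.** For a monotone ring map `φ : K →+* ℝ`, `checkStatic T B = true` implies
the `Static` block of `CertData.Valid (toCertData φ T)`. [folklore] -/
theorem static_of_check (h : T.checkStatic B = true) : (T.toCertData φ).Static := by
  simp only [checkStatic, Bool.and_eq_true] at h
  obtain ⟨⟨⟨⟨⟨⟨haux, hsc⟩, hS⟩, hC⟩, hP⟩, hsl⟩, hD⟩ := h
  obtain ⟨h1, h2, h3, h4, h5, h6, h7, h8, h9, h10, h11, h12, h13, h14, h15, h16, h17, h18⟩ :=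
    T.static_scalars hφ B haux hsc
  have hR : 1 ≤ T.R := by
    have hsc' := hsc
    simp only [checkStaticScalars, Bool.and_eq_true, decide_eq_true_eq] at hsc'
    exact hsc'.1.1.1.1.1.1.1.1.1.1.1.1.1.1.1.1.1
  exact ⟨h1, T.static_tableClass hφ hR hS hC hP, h2, h3, h4, h5, h6, h7, h8, h9, h10, h11, h12, h13, h14, h15, h16,
    h17, h18, T.static_slack hφ B haux hsc hsl, T.static_datum hφ h10 hD⟩

end Assembly

end CertTables

end Summit.NavierStokesRegularity.NavierStokesRegularity.Theorems.TaylorModelCert
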